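import Literature.NumberTheory.Rogawski1990.ArchCentralValueTransferExists      -- ★ p832777: the (S-d) letter `ArchCentralValueTransfer(Exists)(Closed)` (text sliced below)
import Literature.NumberTheory.Automorphic.UnitaryGroupArchUnimodular           -- ★ `UnitaryGroup.modularCharacterFun_arch_antidiagOne_eq_one` (`G_∞` unimodular)
import Literature.NumberTheory.Automorphic.GLnAdelicIntegrationFactsProofs      -- ★ `isMulRightInvariant_of_modularCharacterFun_eq_one`
import HarnessLib

/-!
# The (S-d) letter `ArchCentralValueTransferExists` holds at every VACUOUS frame (no thirteen-conjunct measure system), and a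
# right-invariant Haar measure on `G_∞ = U(Φ₃)(L⁺ ⊗ ℝ)` always exists (Rogawski 1990, §14.5 p. 239; §1.7 p. 6)

Topic `NumberTheory/Rogawski1990`; namespace `Literature.NumberTheory.Rogawski1990` (§1 in `Literature.NumberTheory.Automorphic.UnitaryGroup`).
THEOREMS ONLY (no `def`, no instance, no notation, no attribute, no axiom, no `sorry`).  Cell `pub/hodgecm-mathlib`, ENGINE T1 (crux H413 =
`stmt-HodgeConjecture-24833`), books row III-57 #111 «(S-d) archimedean central-value transfer exists (∃ν on the Haar ray of the canonical pair)», road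
`ROAD-Sd` §0; author F0P3a-p06 (g9) on LEAD DESK WORD T6-66 (1) (F0P3a-plan (g7), 2026-08-31).

WHAT.  ★ `ArchCentralValueTransfer L H′ T ν′ ν ν_H` (p832777) reads «for every hermitian-anisotropic guard `(hherm, hanis, hS₀)`, every choice of
orbit-quotient σ-algebras, every system `(m′, m, m_H, t′, t, t_H)` satisfying the THIRTEEN CONJUNCTS (i)–(vi), (W′)(W)(W_H), (C′)(C)(C′G)(C_H) at
`(ν′, ν, ν_H)`, and every smooth inner-transfer pair `(a′, a)`: `a(ζ•1 ⊗ 1) = a′(ζ•1 ⊗ 1)`»; the LETTER is ★ `ArchCentralValueTransferExists L H′ T ν′ ν_H :=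
∃ ν (Haar, right-invariant), ArchCentralValueTransfer L H′ T ν′ ν ν_H`.  A frame `(L, H′, T, ν′, ν_H)` is VACUOUS when no such system exists at ANY
right-invariant `ν` finite on compacta — e.g. `H′` not `c`-hermitian, or not anisotropic, or definite at no complex place (the three guards), or `T`
degenerate (`¬ IsArchNondegenerate L H′ T`, conjunct (iv)), or no Weil-form admissible family for `ν′`.  There the letter asks only for SOME right-invariant
Haar `ν` on `G_∞`; this file supplies it and records the logic, so that a floor-1 discharge of #111 may `by_cases` straight to the canonical frames.
* §1 `UnitaryGroup.exists_isHaarMeasure_isMulRightInvariant_arch` (`c`-hermitian non-degenerate `H`) and `…_arch_antidiagOne` (`G_∞ = U(Φ_N)(L⁺ ⊗ ℝ)`):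
  for ANY Borel structure a right-invariant Haar measure exists (Mathlib `Measure.haar`; unimodularity ★ `modularCharacterFun_arch(_antidiagOne)_eq_one`;
  ★ `isMulRightInvariant_of_modularCharacterFun_eq_one`).
* §2 `archCentralValueTransfer_of_forall_not` — (S-d) at fixed `(ν′, ν, ν_H)` from «no system at `(ν′, ν, ν_H)`»: the hypothesis quotes the guard, σ-algebra
  and system binders and the thirteen-conjunct body of ★ p832777 :93–:197 TOKEN FOR TOKEN (sliced from the tree bytes by script — a paraphrased system would
  be a different statement); §3 the named vacuous frames at fixed measures and in the `∃ν` shape: `…_of_not_isHermitian`, `…_of_not_anisotropic`,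
  `…_of_not_exists_posDef` (guard `hS₀`), `…_of_not_isArchNondegenerate` (conjunct (iv)); `archCentralValueTransferExists_of_forall_not` — the letter at a
  frame vacuous at every `ν`; its universal closure IS «∀ frames, vacuous → `ArchCentralValueTransferExists …`» = the closed shape ★
  `ArchCentralValueTransferExistsClosed` RESTRICTED to vacuous frames (with the weaker frame instances `IsFiniteMeasureOnCompacts` ∕ right-invariant on
  `ν′`, `ν_H` in place of its `IsHaarMeasure`) — NOT a modification of the ★ letter, whose text is frozen (#111 is discharged only by the ★ def verbatim).
HONEST LABEL.  This does NOT touch the canonical frames (hermitian-anisotropic `H′`, `S₀ ≠ ∅`, non-degenerate `T`, Weil-form systems exist): there the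
witness is print's compatible `ν = c|Ω|` and the identity is Harish-Chandra's limit formula at a central element with matched constants on `G′_∞`, `G_∞`
[Rogawski1990 §8.4 pp. 126–127] — ROAD-Sd §2, floor 1+.  HC_CM is proved only modulo the printed citations until rung 0 closes; this file is count-neutral
(logic + existence of Haar measures on real reductive groups).

## References
* [Rogawski1990] J. D. Rogawski, *Automorphic Representations of Unitary Groups in Three Variables*, Ann. of Math. Stud. 123 (1990): §14.5 p. 239 («If `γ₀`
  is central in `G`, then `f′_v(γ₀) = f_v(γ₀)`»), §14.1 p. 232 (`G′ = U(H′)`, `S₀`), §1.7 p. 6 (Haar measures `dg = c|Ω|`), §8.4 pp. 126–127 (limit formulas).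
* [Knapp2002] A. W. Knapp, *Lie Groups Beyond an Introduction*, 2nd ed. (2002), VIII §2 Cor. 8.31 (reductive Lie groups are unimodular).
* [BorelJacquet1979] A. Borel, H. Jacquet, *Automorphic forms and automorphic representations*, PSPM 33.1 (1979), §4.1 (`G_∞`).
-/

set_option autoImplicit false

noncomputable section

open MeasureTheory MeasureTheory.Measure NumberField NumberField.InfinitePlace IsDedekindDomain
open Literature.MeasureTheory.Group

/-! ## §1 Right-invariant Haar measures on `U(H)(L⁺ ⊗ ℝ)` exist, for any Borel structure -/

namespace Literature.NumberTheory.Automorphic.UnitaryGroup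

variable (L : Type) [Field L] [NumberField L] [IsCMField L]

/-- **A right-invariant Haar measure on `G_∞ = U(H)(L⁺ ⊗ ℝ)` exists** for every `c`-hermitian non-degenerate `H ∈ M_N(L)` and every Borel structure on
the group: Mathlib's `Measure.haar` is a left Haar measure and `U(H)(L⁺ ⊗ ℝ)` is unimodular (★ `modularCharacterFun_arch_eq_one`), hence it is right
invariant (★ `isMulRightInvariant_of_modularCharacterFun_eq_one`). [cite: Knapp2002, VIII.§2 Cor. 8.31] [cite: BorelJacquet1979, §4.1] -/
theorem exists_isHaarMeasure_isMulRightInvariant_arch {N : ℕ} (H : Matrix (Fin N) (Fin N) L)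
    [MeasurableSpace (arch (↥(maximalRealSubfield L)) L (IsCMField.complexConj L) N H)]
    [BorelSpace (arch (↥(maximalRealSubfield L)) L (IsCMField.complexConj L) N H)]
    (hherm : (H.map (cmConjRingHom L)).transpose = H) (hdet : H.det ≠ 0) :
    ∃ ν : Measure (arch (↥(maximalRealSubfield L)) L (IsCMField.complexConj L) N H), ν.IsHaarMeasure ∧ ν.IsMulRightInvariant :=
  ⟨haar, inferInstance, isMulRightInvariant_of_modularCharacterFun_eq_one (modularCharacterFun_arch_eq_one L H hherm hdet) _⟩

/-- **A right-invariant Haar measure on the quasi-split `G_∞ = U(Φ_N)(L⁺ ⊗ ℝ)` exists** (`Φ_N = antidiag(1, …, 1)`), for every Borel structure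
(★ `modularCharacterFun_arch_antidiagOne_eq_one`) — the witness the (S-d) letter asks for at a vacuous frame. [cite: Knapp2002, VIII.§2 Cor. 8.31]
[cite: Rogawski1990, §1.7 p. 6] -/
theorem exists_isHaarMeasure_isMulRightInvariant_arch_antidiagOne (N : ℕ)
    [MeasurableSpace (arch (↥(maximalRealSubfield L)) L (IsCMField.complexConj L) N
      (Matrix.of fun i j : Fin N => if i.val + j.val + 1 = N then (1 : L) else 0))]
    [BorelSpace (arch (↥(maximalRealSubfield L)) L (IsCMField.complexConj L) N
      (Matrix.of fun i j : Fin N => if i.val + j.val + 1 = N then (1 : L) else 0))] :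
    ∃ ν : Measure (arch (↥(maximalRealSubfield L)) L (IsCMField.complexConj L) N
      (Matrix.of fun i j : Fin N => if i.val + j.val + 1 = N then (1 : L) else 0)), ν.IsHaarMeasure ∧ ν.IsMulRightInvariant :=
  ⟨haar, inferInstance, isMulRightInvariant_of_modularCharacterFun_eq_one (modularCharacterFun_arch_antidiagOne_eq_one L N) _⟩

end Literature.NumberTheory.Automorphic.UnitaryGroup

namespace Literature.NumberTheory.Rogawski1990

open Literature.NumberTheory.Automorphic Literature.NumberTheory.GaloisRepresentations
open Literature.AlgebraicGeometry.ShimuraVarieties (unitaryGroup hermForm)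
open scoped Matrix ComplexOrder

section Arch

-- the frame `(L, H′, T, σ-algebras, ν′, ν, ν_H)` of ★ `ArchCentralValueTransfer` (its binders :61, :70–:92, token for token)
variable (L : Type) [Field L] [NumberField L] [IsCMField L] (H' : Matrix (Fin 3) (Fin 3) L) (T : ArchTransferFactor L H')
    [MeasurableSpace (UnitaryGroup.arch (↥(maximalRealSubfield L)) L (IsCMField.complexConj L) 3 H')]
    [BorelSpace (UnitaryGroup.arch (↥(maximalRealSubfield L)) L (IsCMField.complexConj L) 3 H')]
    [MeasurableSpace (UnitaryGroup.arch (↥(maximalRealSubfield L)) L (IsCMField.complexConj L) 3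
      (Matrix.of fun i j : Fin 3 => if i.val + j.val + 1 = 3 then (1 : L) else 0))]
    [BorelSpace (UnitaryGroup.arch (↥(maximalRealSubfield L)) L (IsCMField.complexConj L) 3
      (Matrix.of fun i j : Fin 3 => if i.val + j.val + 1 = 3 then (1 : L) else 0))]
    [MeasurableSpace (UnitaryGroup.arch (↥(maximalRealSubfield L)) L (IsCMField.complexConj L) 2
            (Matrix.of fun i j : Fin 2 => if i.val + j.val + 1 = 2 then (1 : L) else 0) ×
          UnitaryGroup.arch (↥(maximalRealSubfield L)) L (IsCMField.complexConj L) 1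
            (Matrix.of fun i j : Fin 1 => if i.val + j.val + 1 = 1 then (1 : L) else 0))]
    [BorelSpace (UnitaryGroup.arch (↥(maximalRealSubfield L)) L (IsCMField.complexConj L) 2
            (Matrix.of fun i j : Fin 2 => if i.val + j.val + 1 = 2 then (1 : L) else 0) ×
          UnitaryGroup.arch (↥(maximalRealSubfield L)) L (IsCMField.complexConj L) 1
            (Matrix.of fun i j : Fin 1 => if i.val + j.val + 1 = 1 then (1 : L) else 0))]
    (ν' : Measure (UnitaryGroup.arch (↥(maximalRealSubfield L)) L (IsCMField.complexConj L) 3 H'))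
    (ν : Measure (UnitaryGroup.arch (↥(maximalRealSubfield L)) L (IsCMField.complexConj L) 3
      (Matrix.of fun i j : Fin 3 => if i.val + j.val + 1 = 3 then (1 : L) else 0)))
    (νH : Measure (UnitaryGroup.arch (↥(maximalRealSubfield L)) L (IsCMField.complexConj L) 2
            (Matrix.of fun i j : Fin 2 => if i.val + j.val + 1 = 2 then (1 : L) else 0) ×
          UnitaryGroup.arch (↥(maximalRealSubfield L)) L (IsCMField.complexConj L) 1
            (Matrix.of fun i j : Fin 1 => if i.val + j.val + 1 = 1 then (1 : L) else 0)))
    [IsFiniteMeasureOnCompacts ν'] [ν'.IsMulRightInvariant] [IsFiniteMeasureOnCompacts ν] [ν.IsMulRightInvariant]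
    [IsFiniteMeasureOnCompacts νH] [νH.IsMulRightInvariant]

/-! ## §2 (S-d) from vacuity — the guard, σ-algebra and system binders and the thirteen conjuncts quoted from ★ p832777 :93–:197 -/

/-- **(S-d) AT FIXED MEASURES FROM VACUITY**: if at `(ν′, ν, ν_H)` NO guard ∕ σ-algebra ∕ system triple satisfies the thirteen conjuncts (i)–(vi),
(W′)(W)(W_H), (C′)(C)(C′G)(C_H) of ★ `ArchCentralValueTransfer` (quoted token for token), then `ArchCentralValueTransfer L H′ T ν′ ν ν_H` — its conclusion
is never reached.  Pure logic; nothing printed is used. [cite: Rogawski1990, §14.5 p. 239; §1.7 p. 6] -/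
theorem archCentralValueTransfer_of_forall_not
    (hvac : ∀
      (hherm : (H'.map (cmConjRingHom L)).transpose = H')
        (hanis : (∀ x : Fin 3 → L, hermForm (cmConjRingHom L) H' x x = 0 → x = 0))
        (hS₀ : ∃ w : {w : InfinitePlace L // IsComplex w}, (H'.map w.1.embedding).PosDef ∨ (-H'.map w.1.embedding).PosDef)
        {iGpm : ∀ γ' : UnitaryGroup.arch (↥(maximalRealSubfield L)) L (IsCMField.complexConj L) 3 H',
          MeasurableSpace (UnitaryGroup.arch (↥(maximalRealSubfield L)) L (IsCMField.complexConj L) 3 H' ⧸ Subgroup.centralizer ({γ'} : Set (UnitaryGroup.arch (↥(maximalRealSubfield L)) L (IsCMField.complexConj L) 3 H')))}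
        {iGpb : ∀ γ' : UnitaryGroup.arch (↥(maximalRealSubfield L)) L (IsCMField.complexConj L) 3 H',
          BorelSpace (UnitaryGroup.arch (↥(maximalRealSubfield L)) L (IsCMField.complexConj L) 3 H' ⧸ Subgroup.centralizer ({γ'} : Set (UnitaryGroup.arch (↥(maximalRealSubfield L)) L (IsCMField.complexConj L) 3 H')))}
        {iGm : ∀ γ : UnitaryGroup.arch (↥(maximalRealSubfield L)) L (IsCMField.complexConj L) 3
          (Matrix.of fun i j : Fin 3 => if i.val + j.val + 1 = 3 then (1 : L) else 0),
          MeasurableSpace (UnitaryGroup.arch (↥(maximalRealSubfield L)) L (IsCMField.complexConj L) 3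
          (Matrix.of fun i j : Fin 3 => if i.val + j.val + 1 = 3 then (1 : L) else 0) ⧸ Subgroup.centralizer ({γ} : Set (UnitaryGroup.arch (↥(maximalRealSubfield L)) L (IsCMField.complexConj L) 3
          (Matrix.of fun i j : Fin 3 => if i.val + j.val + 1 = 3 then (1 : L) else 0))))}
        {iGb : ∀ γ : UnitaryGroup.arch (↥(maximalRealSubfield L)) L (IsCMField.complexConj L) 3
          (Matrix.of fun i j : Fin 3 => if i.val + j.val + 1 = 3 then (1 : L) else 0),
          BorelSpace (UnitaryGroup.arch (↥(maximalRealSubfield L)) L (IsCMField.complexConj L) 3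
          (Matrix.of fun i j : Fin 3 => if i.val + j.val + 1 = 3 then (1 : L) else 0) ⧸ Subgroup.centralizer ({γ} : Set (UnitaryGroup.arch (↥(maximalRealSubfield L)) L (IsCMField.complexConj L) 3
          (Matrix.of fun i j : Fin 3 => if i.val + j.val + 1 = 3 then (1 : L) else 0))))}
        {iHm : ∀ a : (UnitaryGroup.arch (↥(maximalRealSubfield L)) L (IsCMField.complexConj L) 2
            (Matrix.of fun i j : Fin 2 => if i.val + j.val + 1 = 2 then (1 : L) else 0) ×
          UnitaryGroup.arch (↥(maximalRealSubfield L)) L (IsCMField.complexConj L) 1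
            (Matrix.of fun i j : Fin 1 => if i.val + j.val + 1 = 1 then (1 : L) else 0)),
          MeasurableSpace ((UnitaryGroup.arch (↥(maximalRealSubfield L)) L (IsCMField.complexConj L) 2
            (Matrix.of fun i j : Fin 2 => if i.val + j.val + 1 = 2 then (1 : L) else 0) ×
          UnitaryGroup.arch (↥(maximalRealSubfield L)) L (IsCMField.complexConj L) 1
            (Matrix.of fun i j : Fin 1 => if i.val + j.val + 1 = 1 then (1 : L) else 0)) ⧸ Subgroup.centralizer ({a} : Set ((UnitaryGroup.arch (↥(maximalRealSubfield L)) L (IsCMField.complexConj L) 2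
            (Matrix.of fun i j : Fin 2 => if i.val + j.val + 1 = 2 then (1 : L) else 0) ×
          UnitaryGroup.arch (↥(maximalRealSubfield L)) L (IsCMField.complexConj L) 1
            (Matrix.of fun i j : Fin 1 => if i.val + j.val + 1 = 1 then (1 : L) else 0)))))}
        {iHb : ∀ a : (UnitaryGroup.arch (↥(maximalRealSubfield L)) L (IsCMField.complexConj L) 2
            (Matrix.of fun i j : Fin 2 => if i.val + j.val + 1 = 2 then (1 : L) else 0) ×
          UnitaryGroup.arch (↥(maximalRealSubfield L)) L (IsCMField.complexConj L) 1
            (Matrix.of fun i j : Fin 1 => if i.val + j.val + 1 = 1 then (1 : L) else 0)),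
          BorelSpace ((UnitaryGroup.arch (↥(maximalRealSubfield L)) L (IsCMField.complexConj L) 2
            (Matrix.of fun i j : Fin 2 => if i.val + j.val + 1 = 2 then (1 : L) else 0) ×
          UnitaryGroup.arch (↥(maximalRealSubfield L)) L (IsCMField.complexConj L) 1
            (Matrix.of fun i j : Fin 1 => if i.val + j.val + 1 = 1 then (1 : L) else 0)) ⧸ Subgroup.centralizer ({a} : Set ((UnitaryGroup.arch (↥(maximalRealSubfield L)) L (IsCMField.complexConj L) 2
            (Matrix.of fun i j : Fin 2 => if i.val + j.val + 1 = 2 then (1 : L) else 0) ×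
          UnitaryGroup.arch (↥(maximalRealSubfield L)) L (IsCMField.complexConj L) 1
            (Matrix.of fun i j : Fin 1 => if i.val + j.val + 1 = 1 then (1 : L) else 0)))))}
            (m' : OrbitalMeasureFamily (UnitaryGroup.arch (↥(maximalRealSubfield L)) L (IsCMField.complexConj L) 3 H'))
              (m : OrbitalMeasureFamily (UnitaryGroup.arch (↥(maximalRealSubfield L)) L (IsCMField.complexConj L) 3
                (Matrix.of fun i j : Fin 3 => if i.val + j.val + 1 = 3 then (1 : L) else 0)))
              (mH : OrbitalMeasureFamily (UnitaryGroup.arch (↥(maximalRealSubfield L)) L (IsCMField.complexConj L) 2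
                  (Matrix.of fun i j : Fin 2 => if i.val + j.val + 1 = 2 then (1 : L) else 0) ×
                UnitaryGroup.arch (↥(maximalRealSubfield L)) L (IsCMField.complexConj L) 1
                  (Matrix.of fun i j : Fin 1 => if i.val + j.val + 1 = 1 then (1 : L) else 0)))
              (t' : ∀ γ' : UnitaryGroup.arch (↥(maximalRealSubfield L)) L (IsCMField.complexConj L) 3 H',
                Measure (Subgroup.centralizer ({γ'} : Set (UnitaryGroup.arch (↥(maximalRealSubfield L)) L (IsCMField.complexConj L) 3 H'))))
              (t : ∀ γ : UnitaryGroup.arch (↥(maximalRealSubfield L)) L (IsCMField.complexConj L) 3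
                  (Matrix.of fun i j : Fin 3 => if i.val + j.val + 1 = 3 then (1 : L) else 0),
                Measure (Subgroup.centralizer ({γ} : Set (UnitaryGroup.arch (↥(maximalRealSubfield L)) L (IsCMField.complexConj L) 3
                  (Matrix.of fun i j : Fin 3 => if i.val + j.val + 1 = 3 then (1 : L) else 0)))))
              (tH : ∀ γH : UnitaryGroup.arch (↥(maximalRealSubfield L)) L (IsCMField.complexConj L) 2
                    (Matrix.of fun i j : Fin 2 => if i.val + j.val + 1 = 2 then (1 : L) else 0) ×
                  UnitaryGroup.arch (↥(maximalRealSubfield L)) L (IsCMField.complexConj L) 1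
                    (Matrix.of fun i j : Fin 1 => if i.val + j.val + 1 = 1 then (1 : L) else 0),
                Measure (Subgroup.centralizer ({γH} : Set (UnitaryGroup.arch (↥(maximalRealSubfield L)) L (IsCMField.complexConj L) 2
                    (Matrix.of fun i j : Fin 2 => if i.val + j.val + 1 = 2 then (1 : L) else 0) ×
                  UnitaryGroup.arch (↥(maximalRealSubfield L)) L (IsCMField.complexConj L) 1
                    (Matrix.of fun i j : Fin 1 => if i.val + j.val + 1 = 1 then (1 : L) else 0))))),
        ¬ (
          -- (i)–(vi): the body of ★ `ArchTransfersExist` VERBATIM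
          m'.IsAdmissibleOn (fun γ => IsRegularElt (γ.val : GL (Fin 3) (mixedEmbedding.mixedSpace L))) ∧
            m.IsAdmissibleOn (fun γ => IsRegularElt (γ.val : GL (Fin 3) (mixedEmbedding.mixedSpace L))) ∧
            mH.IsAdmissibleOn (IsArchGRegular L) ∧
            IsArchNondegenerate L H' T ∧
            IsArchInnerTransferExists L H' m' m (ArchSmooth L 3 H')
              (ArchSmooth L 3 (Matrix.of fun i j : Fin 3 => if i.val + j.val + 1 = 3 then (1 : L) else 0)) ∧
            IsArchDeltaTransferExists L H' T mH m' (ArchSmooth L 3 H') (ArchSmooth₂ L) ∧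
          -- (W′)(W)(W_H): Weil form for the given Haar measures
          m'.IsQuotientOf (fun γ => IsRegularElt (γ.val : GL (Fin 3) (mixedEmbedding.mixedSpace L))) ν' t' ∧
            m.IsQuotientOf (fun γ => IsRegularElt (γ.val : GL (Fin 3) (mixedEmbedding.mixedSpace L))) ν t ∧
            mH.IsQuotientOf (IsArchGRegular L) νH tH ∧
          -- (C′): compatibility under stable conjugacy inside `G′_∞`
          (∀ (γ₁ γ₂ : UnitaryGroup.arch (↥(maximalRealSubfield L)) L (IsCMField.complexConj L) 3 H')
              (h₁ : IsRegularElt (γ₁.val : GL (Fin 3) (mixedEmbedding.mixedSpace L)))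
              (hc : Corresponds (UnitaryGroup.conjMixed (↥(maximalRealSubfield L)) L (IsCMField.complexConj L))
                (UnitaryGroup.archFormOf L 3 H') (UnitaryGroup.archFormOf L 3 H') γ₁ γ₂),
              Measure.map ⇑(UnitaryGroup.archStableCentralizerEquiv L (Godement.det_ne_zero_of_anisotropic L H' hanis)
                (Godement.det_ne_zero_of_anisotropic L H' hanis) hc h₁) (t' γ₁) = t' γ₂) ∧
          -- (C): compatibility under stable conjugacy inside `G_∞`
          (∀ (γ₁ γ₂ : UnitaryGroup.arch (↥(maximalRealSubfield L)) L (IsCMField.complexConj L) 3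
                (Matrix.of fun i j : Fin 3 => if i.val + j.val + 1 = 3 then (1 : L) else 0))
              (h₁ : IsRegularElt (γ₁.val : GL (Fin 3) (mixedEmbedding.mixedSpace L)))
              (hc : Corresponds (UnitaryGroup.conjMixed (↥(maximalRealSubfield L)) L (IsCMField.complexConj L))
                (UnitaryGroup.archFormOf L 3 (Matrix.of fun i j : Fin 3 => if i.val + j.val + 1 = 3 then (1 : L) else 0))
                (UnitaryGroup.archFormOf L 3 (Matrix.of fun i j : Fin 3 => if i.val + j.val + 1 = 3 then (1 : L) else 0)) γ₁ γ₂),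
              Measure.map ⇑(UnitaryGroup.archStableCentralizerEquiv L (UnitaryGroup.isUnit_antidiagOne_det L 3).ne_zero
                (UnitaryGroup.isUnit_antidiagOne_det L 3).ne_zero hc h₁) (t γ₁) = t γ₂) ∧
          -- (C′G): compatibility under the inner twist `G′_∞ ↔ G_∞`
          (∀ (γ' : UnitaryGroup.arch (↥(maximalRealSubfield L)) L (IsCMField.complexConj L) 3 H')
              (γ : UnitaryGroup.arch (↥(maximalRealSubfield L)) L (IsCMField.complexConj L) 3
                (Matrix.of fun i j : Fin 3 => if i.val + j.val + 1 = 3 then (1 : L) else 0))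
              (h' : IsRegularElt (γ'.val : GL (Fin 3) (mixedEmbedding.mixedSpace L)))
              (hc : Corresponds (UnitaryGroup.conjMixed (↥(maximalRealSubfield L)) L (IsCMField.complexConj L))
                (UnitaryGroup.archFormOf L 3 H')
                (UnitaryGroup.archFormOf L 3 (Matrix.of fun i j : Fin 3 => if i.val + j.val + 1 = 3 then (1 : L) else 0)) γ' γ),
              Measure.map ⇑(UnitaryGroup.archStableCentralizerEquiv L (Godement.det_ne_zero_of_anisotropic L H' hanis)
                (UnitaryGroup.isUnit_antidiagOne_det L 3).ne_zero hc h') (t' γ') = t γ) ∧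
          -- (C_H): compatibility along the endoscopic embedding `ι_∞ : H_∞ → G_∞` at the `G`-regular elements
          (∀ γH : UnitaryGroup.arch (↥(maximalRealSubfield L)) L (IsCMField.complexConj L) 2
                (Matrix.of fun i j : Fin 2 => if i.val + j.val + 1 = 2 then (1 : L) else 0) ×
              UnitaryGroup.arch (↥(maximalRealSubfield L)) L (IsCMField.complexConj L) 1
                (Matrix.of fun i j : Fin 1 => if i.val + j.val + 1 = 1 then (1 : L) else 0),
              IsArchGRegular L γH → Measure.map ⇑(endoEmbArchCentralizer L γH) (tH γH) = t (endoEmbArch L γH)))) :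
    ArchCentralValueTransfer L H' T ν' ν νH := by
  intro hherm hanis hS₀ iGpm iGpb iGm iGb iHm iHb m' m mH t' t tH hbody
  exact (@hvac hherm hanis hS₀ iGpm iGpb iGm iGb iHm iHb m' m mH t' t tH hbody).elim

/-! ## §3 The named vacuous frames: a failing guard, or a degenerate archimedean transfer factor (conjunct (iv)) -/

/-- **(S-d) at fixed measures, vacuously, when `H′` is NOT `c`-hermitian (the guard `hherm` of ★ `ArchCentralValueTransfer` fails).** [cite: Rogawski1990, §14.5 p. 239; §14.1 p. 232] -/
theorem archCentralValueTransfer_of_not_isHermitian (h : ¬ (H'.map (cmConjRingHom L)).transpose = H') :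
    ArchCentralValueTransfer L H' T ν' ν νH :=
  fun hherm _ _ _ _ _ _ _ _ _ _ _ _ _ _ _ => (h hherm).elim

/-- **(S-d) at fixed measures, vacuously, when `H′` is NOT anisotropic (the guard `hanis` fails; print's `G′ = U(H′)` has `H′` anisotropic, §14.1 p. 232).** [cite: Rogawski1990, §14.5 p. 239; §14.1 p. 232] -/
theorem archCentralValueTransfer_of_not_anisotropic (h : ¬ ∀ x : Fin 3 → L, hermForm (cmConjRingHom L) H' x x = 0 → x = 0) :
    ArchCentralValueTransfer L H' T ν' ν νH :=
  fun _ hanis _ _ _ _ _ _ _ _ _ _ _ _ _ _ => (h hanis).elim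

/-- **(S-d) at fixed measures, vacuously, when `H′` is definite at NO complex place (the guard `hS₀` — print's «`S₀ ≠ ∅`», §14.1 p. 232 — fails).** [cite: Rogawski1990, §14.5 p. 239; §14.1 p. 232] -/
theorem archCentralValueTransfer_of_not_exists_posDef (h : ¬ ∃ w : {w : InfinitePlace L // IsComplex w}, (H'.map w.1.embedding).PosDef ∨ (-H'.map w.1.embedding).PosDef) :
    ArchCentralValueTransfer L H' T ν' ν νH :=
  fun _ _ hS₀ _ _ _ _ _ _ _ _ _ _ _ _ _ => (h hS₀).elim

/-- **(S-d) at fixed measures, vacuously, when the archimedean transfer factor `T` is DEGENERATE (conjunct (iv) `IsArchNondegenerate L H′ T` of every system fails, so no system exists).** [cite: Rogawski1990, §14.5 p. 239; §14.1 p. 232] -/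
theorem archCentralValueTransfer_of_not_isArchNondegenerate (h : ¬ IsArchNondegenerate L H' T) :
    ArchCentralValueTransfer L H' T ν' ν νH :=
  fun _ _ _ _ _ _ _ _ _ _ _ _ _ _ _ hbody => (h hbody.2.2.2.1).elim

/-- **The (S-d) letter (`∃ν` shape), vacuously, when `H′` is NOT `c`-hermitian (the guard `hherm` of ★ `ArchCentralValueTransfer` fails)** — witness: §1's right-invariant Haar measure on `G_∞`.
[cite: Rogawski1990, §14.5 p. 239; §1.7 p. 6] -/
theorem archCentralValueTransferExists_of_not_isHermitian (h : ¬ (H'.map (cmConjRingHom L)).transpose = H') :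
    ArchCentralValueTransferExists L H' T ν' νH := by
  obtain ⟨ν, hν, hνr⟩ := UnitaryGroup.exists_isHaarMeasure_isMulRightInvariant_arch_antidiagOne L 3
  exact ⟨ν, hν, hνr, archCentralValueTransfer_of_not_isHermitian L H' T ν' ν νH h⟩

/-- **The (S-d) letter (`∃ν` shape), vacuously, when `H′` is NOT anisotropic (the guard `hanis` fails; print's `G′ = U(H′)` has `H′` anisotropic, §14.1 p. 232)** — witness: §1's right-invariant Haar measure on `G_∞`.
[cite: Rogawski1990, §14.5 p. 239; §1.7 p. 6] -/
theorem archCentralValueTransferExists_of_not_anisotropic (h : ¬ ∀ x : Fin 3 → L, hermForm (cmConjRingHom L) H' x x = 0 → x = 0) :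
    ArchCentralValueTransferExists L H' T ν' νH := by
  obtain ⟨ν, hν, hνr⟩ := UnitaryGroup.exists_isHaarMeasure_isMulRightInvariant_arch_antidiagOne L 3
  exact ⟨ν, hν, hνr, archCentralValueTransfer_of_not_anisotropic L H' T ν' ν νH h⟩

/-- **The (S-d) letter (`∃ν` shape), vacuously, when `H′` is definite at NO complex place (the guard `hS₀` — print's «`S₀ ≠ ∅`», §14.1 p. 232 — fails)** — witness: §1's right-invariant Haar measure on `G_∞`.
[cite: Rogawski1990, §14.5 p. 239; §1.7 p. 6] -/
theorem archCentralValueTransferExists_of_not_exists_posDef (h : ¬ ∃ w : {w : InfinitePlace L // IsComplex w}, (H'.map w.1.embedding).PosDef ∨ (-H'.map w.1.embedding).PosDef) :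
    ArchCentralValueTransferExists L H' T ν' νH := by
  obtain ⟨ν, hν, hνr⟩ := UnitaryGroup.exists_isHaarMeasure_isMulRightInvariant_arch_antidiagOne L 3
  exact ⟨ν, hν, hνr, archCentralValueTransfer_of_not_exists_posDef L H' T ν' ν νH h⟩

/-- **The (S-d) letter (`∃ν` shape), vacuously, when the archimedean transfer factor `T` is DEGENERATE (conjunct (iv) `IsArchNondegenerate L H′ T` of every system fails, so no system exists)** — witness: §1's right-invariant Haar measure on `G_∞`.
[cite: Rogawski1990, §14.5 p. 239; §1.7 p. 6] -/
theorem archCentralValueTransferExists_of_not_isArchNondegenerate (h : ¬ IsArchNondegenerate L H' T) :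
    ArchCentralValueTransferExists L H' T ν' νH := by
  obtain ⟨ν, hν, hνr⟩ := UnitaryGroup.exists_isHaarMeasure_isMulRightInvariant_arch_antidiagOne L 3
  exact ⟨ν, hν, hνr, archCentralValueTransfer_of_not_isArchNondegenerate L H' T ν' ν νH h⟩

/-- **THE LETTER AT A VACUOUS FRAME**: if at `(L, H′, T, ν′, ν_H)` no thirteen-conjunct system exists at ANY right-invariant `ν` finite on compacta,
then `ArchCentralValueTransferExists L H′ T ν′ ν_H`, witnessed by §1's right-invariant Haar measure.  This is ALL the letter says off the canonical frames
and says nothing on them (there: Harish-Chandra's limit formula, ROAD-Sd §2). [cite: Rogawski1990, §14.5 p. 239; §1.7 p. 6] [cite: Knapp2002, VIII.§2 Cor. 8.31] -/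
theorem archCentralValueTransferExists_of_forall_not
    (hvac : ∀ (ν : Measure (UnitaryGroup.arch (↥(maximalRealSubfield L)) L (IsCMField.complexConj L) 3
      (Matrix.of fun i j : Fin 3 => if i.val + j.val + 1 = 3 then (1 : L) else 0)))
        [IsFiniteMeasureOnCompacts ν] [ν.IsMulRightInvariant], ∀
      (hherm : (H'.map (cmConjRingHom L)).transpose = H')
        (hanis : (∀ x : Fin 3 → L, hermForm (cmConjRingHom L) H' x x = 0 → x = 0))
        (hS₀ : ∃ w : {w : InfinitePlace L // IsComplex w}, (H'.map w.1.embedding).PosDef ∨ (-H'.map w.1.embedding).PosDef)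
        {iGpm : ∀ γ' : UnitaryGroup.arch (↥(maximalRealSubfield L)) L (IsCMField.complexConj L) 3 H',
          MeasurableSpace (UnitaryGroup.arch (↥(maximalRealSubfield L)) L (IsCMField.complexConj L) 3 H' ⧸ Subgroup.centralizer ({γ'} : Set (UnitaryGroup.arch (↥(maximalRealSubfield L)) L (IsCMField.complexConj L) 3 H')))}
        {iGpb : ∀ γ' : UnitaryGroup.arch (↥(maximalRealSubfield L)) L (IsCMField.complexConj L) 3 H',
          BorelSpace (UnitaryGroup.arch (↥(maximalRealSubfield L)) L (IsCMField.complexConj L) 3 H' ⧸ Subgroup.centralizer ({γ'} : Set (UnitaryGroup.arch (↥(maximalRealSubfield L)) L (IsCMField.complexConj L) 3 H')))}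
        {iGm : ∀ γ : UnitaryGroup.arch (↥(maximalRealSubfield L)) L (IsCMField.complexConj L) 3
          (Matrix.of fun i j : Fin 3 => if i.val + j.val + 1 = 3 then (1 : L) else 0),
          MeasurableSpace (UnitaryGroup.arch (↥(maximalRealSubfield L)) L (IsCMField.complexConj L) 3
          (Matrix.of fun i j : Fin 3 => if i.val + j.val + 1 = 3 then (1 : L) else 0) ⧸ Subgroup.centralizer ({γ} : Set (UnitaryGroup.arch (↥(maximalRealSubfield L)) L (IsCMField.complexConj L) 3
          (Matrix.of fun i j : Fin 3 => if i.val + j.val + 1 = 3 then (1 : L) else 0))))}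
        {iGb : ∀ γ : UnitaryGroup.arch (↥(maximalRealSubfield L)) L (IsCMField.complexConj L) 3
          (Matrix.of fun i j : Fin 3 => if i.val + j.val + 1 = 3 then (1 : L) else 0),
          BorelSpace (UnitaryGroup.arch (↥(maximalRealSubfield L)) L (IsCMField.complexConj L) 3
          (Matrix.of fun i j : Fin 3 => if i.val + j.val + 1 = 3 then (1 : L) else 0) ⧸ Subgroup.centralizer ({γ} : Set (UnitaryGroup.arch (↥(maximalRealSubfield L)) L (IsCMField.complexConj L) 3
          (Matrix.of fun i j : Fin 3 => if i.val + j.val + 1 = 3 then (1 : L) else 0))))}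
        {iHm : ∀ a : (UnitaryGroup.arch (↥(maximalRealSubfield L)) L (IsCMField.complexConj L) 2
            (Matrix.of fun i j : Fin 2 => if i.val + j.val + 1 = 2 then (1 : L) else 0) ×
          UnitaryGroup.arch (↥(maximalRealSubfield L)) L (IsCMField.complexConj L) 1
            (Matrix.of fun i j : Fin 1 => if i.val + j.val + 1 = 1 then (1 : L) else 0)),
          MeasurableSpace ((UnitaryGroup.arch (↥(maximalRealSubfield L)) L (IsCMField.complexConj L) 2
            (Matrix.of fun i j : Fin 2 => if i.val + j.val + 1 = 2 then (1 : L) else 0) ×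
          UnitaryGroup.arch (↥(maximalRealSubfield L)) L (IsCMField.complexConj L) 1
            (Matrix.of fun i j : Fin 1 => if i.val + j.val + 1 = 1 then (1 : L) else 0)) ⧸ Subgroup.centralizer ({a} : Set ((UnitaryGroup.arch (↥(maximalRealSubfield L)) L (IsCMField.complexConj L) 2
            (Matrix.of fun i j : Fin 2 => if i.val + j.val + 1 = 2 then (1 : L) else 0) ×
          UnitaryGroup.arch (↥(maximalRealSubfield L)) L (IsCMField.complexConj L) 1
            (Matrix.of fun i j : Fin 1 => if i.val + j.val + 1 = 1 then (1 : L) else 0)))))}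
        {iHb : ∀ a : (UnitaryGroup.arch (↥(maximalRealSubfield L)) L (IsCMField.complexConj L) 2
            (Matrix.of fun i j : Fin 2 => if i.val + j.val + 1 = 2 then (1 : L) else 0) ×
          UnitaryGroup.arch (↥(maximalRealSubfield L)) L (IsCMField.complexConj L) 1
            (Matrix.of fun i j : Fin 1 => if i.val + j.val + 1 = 1 then (1 : L) else 0)),
          BorelSpace ((UnitaryGroup.arch (↥(maximalRealSubfield L)) L (IsCMField.complexConj L) 2
            (Matrix.of fun i j : Fin 2 => if i.val + j.val + 1 = 2 then (1 : L) else 0) ×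
          UnitaryGroup.arch (↥(maximalRealSubfield L)) L (IsCMField.complexConj L) 1
            (Matrix.of fun i j : Fin 1 => if i.val + j.val + 1 = 1 then (1 : L) else 0)) ⧸ Subgroup.centralizer ({a} : Set ((UnitaryGroup.arch (↥(maximalRealSubfield L)) L (IsCMField.complexConj L) 2
            (Matrix.of fun i j : Fin 2 => if i.val + j.val + 1 = 2 then (1 : L) else 0) ×
          UnitaryGroup.arch (↥(maximalRealSubfield L)) L (IsCMField.complexConj L) 1
            (Matrix.of fun i j : Fin 1 => if i.val + j.val + 1 = 1 then (1 : L) else 0)))))}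
            (m' : OrbitalMeasureFamily (UnitaryGroup.arch (↥(maximalRealSubfield L)) L (IsCMField.complexConj L) 3 H'))
              (m : OrbitalMeasureFamily (UnitaryGroup.arch (↥(maximalRealSubfield L)) L (IsCMField.complexConj L) 3
                (Matrix.of fun i j : Fin 3 => if i.val + j.val + 1 = 3 then (1 : L) else 0)))
              (mH : OrbitalMeasureFamily (UnitaryGroup.arch (↥(maximalRealSubfield L)) L (IsCMField.complexConj L) 2
                  (Matrix.of fun i j : Fin 2 => if i.val + j.val + 1 = 2 then (1 : L) else 0) ×
                UnitaryGroup.arch (↥(maximalRealSubfield L)) L (IsCMField.complexConj L) 1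
                  (Matrix.of fun i j : Fin 1 => if i.val + j.val + 1 = 1 then (1 : L) else 0)))
              (t' : ∀ γ' : UnitaryGroup.arch (↥(maximalRealSubfield L)) L (IsCMField.complexConj L) 3 H',
                Measure (Subgroup.centralizer ({γ'} : Set (UnitaryGroup.arch (↥(maximalRealSubfield L)) L (IsCMField.complexConj L) 3 H'))))
              (t : ∀ γ : UnitaryGroup.arch (↥(maximalRealSubfield L)) L (IsCMField.complexConj L) 3
                  (Matrix.of fun i j : Fin 3 => if i.val + j.val + 1 = 3 then (1 : L) else 0),
                Measure (Subgroup.centralizer ({γ} : Set (UnitaryGroup.arch (↥(maximalRealSubfield L)) L (IsCMField.complexConj L) 3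
                  (Matrix.of fun i j : Fin 3 => if i.val + j.val + 1 = 3 then (1 : L) else 0)))))
              (tH : ∀ γH : UnitaryGroup.arch (↥(maximalRealSubfield L)) L (IsCMField.complexConj L) 2
                    (Matrix.of fun i j : Fin 2 => if i.val + j.val + 1 = 2 then (1 : L) else 0) ×
                  UnitaryGroup.arch (↥(maximalRealSubfield L)) L (IsCMField.complexConj L) 1
                    (Matrix.of fun i j : Fin 1 => if i.val + j.val + 1 = 1 then (1 : L) else 0),
                Measure (Subgroup.centralizer ({γH} : Set (UnitaryGroup.arch (↥(maximalRealSubfield L)) L (IsCMField.complexConj L) 2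
                    (Matrix.of fun i j : Fin 2 => if i.val + j.val + 1 = 2 then (1 : L) else 0) ×
                  UnitaryGroup.arch (↥(maximalRealSubfield L)) L (IsCMField.complexConj L) 1
                    (Matrix.of fun i j : Fin 1 => if i.val + j.val + 1 = 1 then (1 : L) else 0))))),
        ¬ (
          -- (i)–(vi): the body of ★ `ArchTransfersExist` VERBATIM
          m'.IsAdmissibleOn (fun γ => IsRegularElt (γ.val : GL (Fin 3) (mixedEmbedding.mixedSpace L))) ∧
            m.IsAdmissibleOn (fun γ => IsRegularElt (γ.val : GL (Fin 3) (mixedEmbedding.mixedSpace L))) ∧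
            mH.IsAdmissibleOn (IsArchGRegular L) ∧
            IsArchNondegenerate L H' T ∧
            IsArchInnerTransferExists L H' m' m (ArchSmooth L 3 H')
              (ArchSmooth L 3 (Matrix.of fun i j : Fin 3 => if i.val + j.val + 1 = 3 then (1 : L) else 0)) ∧
            IsArchDeltaTransferExists L H' T mH m' (ArchSmooth L 3 H') (ArchSmooth₂ L) ∧
          -- (W′)(W)(W_H): Weil form for the given Haar measures
          m'.IsQuotientOf (fun γ => IsRegularElt (γ.val : GL (Fin 3) (mixedEmbedding.mixedSpace L))) ν' t' ∧
            m.IsQuotientOf (fun γ => IsRegularElt (γ.val : GL (Fin 3) (mixedEmbedding.mixedSpace L))) ν t ∧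
            mH.IsQuotientOf (IsArchGRegular L) νH tH ∧
          -- (C′): compatibility under stable conjugacy inside `G′_∞`
          (∀ (γ₁ γ₂ : UnitaryGroup.arch (↥(maximalRealSubfield L)) L (IsCMField.complexConj L) 3 H')
              (h₁ : IsRegularElt (γ₁.val : GL (Fin 3) (mixedEmbedding.mixedSpace L)))
              (hc : Corresponds (UnitaryGroup.conjMixed (↥(maximalRealSubfield L)) L (IsCMField.complexConj L))
                (UnitaryGroup.archFormOf L 3 H') (UnitaryGroup.archFormOf L 3 H') γ₁ γ₂),
              Measure.map ⇑(UnitaryGroup.archStableCentralizerEquiv L (Godement.det_ne_zero_of_anisotropic L H' hanis)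
                (Godement.det_ne_zero_of_anisotropic L H' hanis) hc h₁) (t' γ₁) = t' γ₂) ∧
          -- (C): compatibility under stable conjugacy inside `G_∞`
          (∀ (γ₁ γ₂ : UnitaryGroup.arch (↥(maximalRealSubfield L)) L (IsCMField.complexConj L) 3
                (Matrix.of fun i j : Fin 3 => if i.val + j.val + 1 = 3 then (1 : L) else 0))
              (h₁ : IsRegularElt (γ₁.val : GL (Fin 3) (mixedEmbedding.mixedSpace L)))
              (hc : Corresponds (UnitaryGroup.conjMixed (↥(maximalRealSubfield L)) L (IsCMField.complexConj L))
                (UnitaryGroup.archFormOf L 3 (Matrix.of fun i j : Fin 3 => if i.val + j.val + 1 = 3 then (1 : L) else 0))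
                (UnitaryGroup.archFormOf L 3 (Matrix.of fun i j : Fin 3 => if i.val + j.val + 1 = 3 then (1 : L) else 0)) γ₁ γ₂),
              Measure.map ⇑(UnitaryGroup.archStableCentralizerEquiv L (UnitaryGroup.isUnit_antidiagOne_det L 3).ne_zero
                (UnitaryGroup.isUnit_antidiagOne_det L 3).ne_zero hc h₁) (t γ₁) = t γ₂) ∧
          -- (C′G): compatibility under the inner twist `G′_∞ ↔ G_∞`
          (∀ (γ' : UnitaryGroup.arch (↥(maximalRealSubfield L)) L (IsCMField.complexConj L) 3 H')
              (γ : UnitaryGroup.arch (↥(maximalRealSubfield L)) L (IsCMField.complexConj L) 3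
                (Matrix.of fun i j : Fin 3 => if i.val + j.val + 1 = 3 then (1 : L) else 0))
              (h' : IsRegularElt (γ'.val : GL (Fin 3) (mixedEmbedding.mixedSpace L)))
              (hc : Corresponds (UnitaryGroup.conjMixed (↥(maximalRealSubfield L)) L (IsCMField.complexConj L))
                (UnitaryGroup.archFormOf L 3 H')
                (UnitaryGroup.archFormOf L 3 (Matrix.of fun i j : Fin 3 => if i.val + j.val + 1 = 3 then (1 : L) else 0)) γ' γ),
              Measure.map ⇑(UnitaryGroup.archStableCentralizerEquiv L (Godement.det_ne_zero_of_anisotropic L H' hanis)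
                (UnitaryGroup.isUnit_antidiagOne_det L 3).ne_zero hc h') (t' γ') = t γ) ∧
          -- (C_H): compatibility along the endoscopic embedding `ι_∞ : H_∞ → G_∞` at the `G`-regular elements
          (∀ γH : UnitaryGroup.arch (↥(maximalRealSubfield L)) L (IsCMField.complexConj L) 2
                (Matrix.of fun i j : Fin 2 => if i.val + j.val + 1 = 2 then (1 : L) else 0) ×
              UnitaryGroup.arch (↥(maximalRealSubfield L)) L (IsCMField.complexConj L) 1
                (Matrix.of fun i j : Fin 1 => if i.val + j.val + 1 = 1 then (1 : L) else 0),
              IsArchGRegular L γH → Measure.map ⇑(endoEmbArchCentralizer L γH) (tH γH) = t (endoEmbArch L γH)))) :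
    ArchCentralValueTransferExists L H' T ν' νH := by
  obtain ⟨ν, hν, hνr⟩ := UnitaryGroup.exists_isHaarMeasure_isMulRightInvariant_arch_antidiagOne L 3
  exact ⟨ν, hν, hνr, archCentralValueTransfer_of_forall_not L H' T ν' ν νH (hvac ν)⟩

end Arch

end Literature.NumberTheory.Rogawski1990

end
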